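import Literature.Barriers.QuantumAdvantage.PPolyOraclesThm76QuantumBounds
import HarnessLib

/-!
# Aaronson–Chen 2017, Lemma 7.5 (2)–(3): the two kernel bounds of the quantum core

Companion of `PPolyOraclesThm76.lean` towards the discharge of `aaronsonChen2017_lem75_quantum`
(arXiv:1612.05903, App. 13 p. 42). The decision of the distinguisher is a function of the
measured output string `y` of its quantum core `family P` (`PeriodFindingFamily.lean`): the control
bits sit on the wires `n, …, n + k₁ − 1` (`ctlOf`), are structured by `eCtl` (`readOf`), and the
event is `Found` (`PPolyOraclesThm76QuantumBounds.lean`). By the Born rule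
(`toReal_outputPMF_map_ofFn`) and the read-out law (`family_law`) the kernel probability of any
event of the structured read-out is its probability under the product law (`kernelProb_readOf`),
whence, on the oracle `acLang W`:

* `kernelProb_found_le` — `≤ 1/4` on a permutation level (Lemma 7.5 (3), first half);
* `kernelProb_found_ge` — `≥ 2/3` on a `PRF^mod` level `modTbl F ℓ n k a` (Lemma 7.5 (2)),
  for input lengths above explicit thresholds.

## References

* [AaronsonChen2017] arXiv:1612.05903, Lemma 7.5 (p. 30), App. 13 (p. 42).
* [NielsenChuang2010] §2.2.5 (Born rule).
-/

noncomputable section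

namespace Literature.Barriers.QuantumAdvantage

open _root_.Computability Literature.Computability.Complexity Literature.Computability.Cryptography
  Literature.Computability.Cryptography.PeriodFinding Literature.Computability.Cryptography.Kitaev1995
  Literature.Computability.Cryptography.Shor1997 Finset
open Literature.Computability.QuantumComplexity (toReal_outputPMF_map_ofFn)

variable (P : FParams) (n : ℕ)

/-! ### The kernel of the family -/

/-- **The kernel probability of an event of the structured read-out is its probability under the
product law.** [cite: NielsenChuang2010, §2.2.5] [cite: AaronsonChen2017, App. 13] -/
theorem kernelProb_readOf (A : Language Bool) (x : List Bool) (E : Finset (Readout P x.length)) :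
    (family P).kernelProb A x {y | readOf P x.length y ∈ E} = prob (lawOf P x.length A) E := by
  classical
  unfold QCircuitFamily.kernelProb QCircuitFamily.kernel lawOf
  rw [toReal_outputPMF_map_ofFn]
  exact family_law_str P x.length A x.get E

/-! ### The permutation case -/

variable {ℓ : ℕ → ℕ}

/-- **Lemma 7.5 (3), quantum half**: on a permutation level, for inputs of length `n` with
`4608 · nL ≤ ⌊√(2ⁿ)⌋`, a period is found with probability at most `1/4`.
[cite: AaronsonChen2017, Lemma 7.5 (3), App. 13] -/
theorem kernelProb_found_le (W : Tables ℓ) (x : List Bool) (hW : Function.Bijective (W x.length))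
    (hbig : 4608 * nL P x.length ≤ Nat.sqrt (2 ^ x.length)) :
    (family P).kernelProb (acLang W) x {y | Found P x.length (readOf P x.length y)} ≤ 1 / 4 := by
  have h := kernelProb_readOf P (acLang W) x (univ.filter (Found P x.length))
  simp only [mem_filter, mem_univ, true_and] at h
  rw [h]
  refine prob_found_le P x.length (acLang W) (fun u => ?_) hbig
  by_cases hL : Lof P x.length u = ℓ x.length
  · exact Fu_injOn_of_bijective P W x.length u hL hW
  · exact Fu_injOn_of_ne P W x.length u hL

/-! ### The `PRF^mod` case -/

/-- **Lemma 7.5 (2)**: on the level `modTbl F ℓ n k a` of a `PRP` (`n = |x|`, `n ≤ ℓ n ≤ n + Lmax n`),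
for inputs with `⌊√(2ⁿ)⌋ ≥ max (4 · 5 + 3) shorThreshold`, a period is found with probability at
least `2/3`. [cite: AaronsonChen2017, Lemma 7.5 (2), App. 13] -/
theorem kernelProb_found_ge {F : FunctionEnsemble} {κ : ℕ → ℕ} (hF : IsPRP F κ ℓ) (W : Tables ℓ)
    (x : List Bool) (hℓ : x.length ≤ ℓ x.length) (hL : ℓ x.length ≤ x.length + P.Lmax x.length)
    {k : List Bool} (hk : k.length = κ x.length) {a : ℕ} (ha : a ∈ zhandryModuli (2 ^ ℓ x.length))
    (hW : W x.length = modTbl F ℓ x.length k a)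
    (hthr : shorThreshold ≤ Nat.sqrt (2 ^ x.length)) (h23 : 23 ≤ Nat.sqrt (2 ^ x.length)) :
    (2 : ℝ) / 3 ≤ (family P).kernelProb (acLang W) x {y | Found P x.length (readOf P x.length y)} := by
  set n := x.length with hn
  have h := kernelProb_readOf P (acLang W) x (univ.filter (Found P n))
  simp only [mem_filter, mem_univ, true_and] at h
  rw [h]
  -- the length index of the true block length
  have hli : ℓ n - n < nL P n := by unfold nL; omega
  set li : Fin (nL P n) := ⟨ℓ n - n, hli⟩ with hli'
  have hnli : n + (li : ℕ) = ℓ n := by simp [hli']; omega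
  -- numerics at the true length
  have hmono : Nat.sqrt (2 ^ n) ≤ Nat.sqrt (2 ^ (n + li)) :=
    Nat.sqrt_le_sqrt (Nat.pow_le_pow_right (by norm_num) (by omega))
  obtain ⟨ha4, ha2, hap⟩ := mem_zhandryModuli.1 ha
  rw [← hnli] at ha4 ha2
  have ha5 : 5 ≤ a := le_trans (by omega) ha4
  have hs1 : 1 ≤ Nat.sqrt (2 ^ (n + li)) := le_trans (by omega) hmono
  have haS : a < Nat.sqrt (2 ^ (n + li)) := lt_of_le_of_lt ha2 (Nat.div_lt_self hs1 (by norm_num))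
  refine prob_found_ge P n (acLang W) li hap ha5 (fun w => F n k (natBits (ℓ n) w))
    (prpTable_injOn n hF hk ha) (fun u hu v hv => ?_) (hthr.trans hmono) (le_trans (by omega) hmono) haS
  have hLu : Lof P n u = ℓ n := (Lof_eq_of_mem P n hu).trans hnli
  exact Fu_eq_periodic P W n hF u hLu hk a hW v hv

end Literature.Barriers.QuantumAdvantage

end
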